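import Summits.FinalStateConjecture.FinalStateConjecture.Theorems.ClusterCompletenessRecurrentlyFlatDispersesCausalFuture
import Summits.FinalStateConjecture.FinalStateConjecture.Theorems.ClusterCompletenessRecurrentlyFlatDispersesChartTimeExhaustive
import Literature.Geometry.Lorentzian.CorrespondingBoundaryExtensionPrep
import Literature.Geometry.Lorentzian.GeodesicRayEndless
import Literature.Geometry.Lorentzian.GeodesicMaximalFlow
import Literature.Geometry.Lorentzian.FutureNullCompleteness
import Literature.Geometry.Lorentzian.LeviCivitaProofs

/-!
# Crux `RecurrentlyFlatDisperses` (stmt-FinalStateConjecture-14665), line `Sketch` — a normalised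
# null ray which meets the anchored chart region stays in it and reaches every late region

Continuation lead c5, 2026-08-16 (brick `RayCapture`, the `stub_scri` side). The geometric half of
any future "entering-sojourn" argument for the `𝓘⁺` half of the crux: once a normalised null ray
`γ` of the development (a maximal null geodesic from the data, `IsNormalisedNullRayFrom`) meets the
late image `W = Ψ₀{x⁰ > τ₀}` of the crux's anchored flat chart at an affine parameter `t₁`, then

* it stays in `W` for all later parameters of its domain (`J⁺(W) ⊆ W`, the landed
  `causalFuture_image_lateRegion_subset`, and a null ray is a future causal curve:
  `IsGeodesicOn.isNull_and_isFutureDirected_velocity`), and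
* for every chart time `T` it reaches the region `Ψ₀{x⁰ > T}` at some later parameter of its domain
  (the landed `exists_mem_image_lateRegion`, applied to the final segment `dom ∩ [t₁, ∞)`).

The second point needs the final segment of the ray to be FUTURE ENDLESS (no future endpoint). This
is supplied here in Literature generality (`RayCapture.isFutureEndless_inter_Ici_of_isMaximalGeodesicOn`):
a maximal geodesic of a `C^∞` connection with nowhere-vanishing velocity has no future endpoint on
any final segment of its domain — if the domain is unbounded above this is the tree's
`IsGeodesicOn.isFutureEndless_Ici_of_velocity_ne_zero` (an affinely parametrised ray does not
converge); if it is bounded above, with supremum `b ∉ dom`, a left limit `γ t → z` as `t ↑ b` would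
make `γ` extendible as a geodesic past `b` (O'Neill 1983, Ch. 5, Lemma 8: in a uniformly normal
neighbourhood of `z` the re-based ray is radial, `γ (t₂ + r (b - t₂)) = exp_q (r v)`, and a radial
geodesic which converges as `r ↑ 1` reaches its limit at `r = 1`, the tree's
`twoPoint_expInverse_eq_of_tendsto_radial`; so `b - t₂ ∈ dom γ_w` and `b ∈ dom` by maximality),
`RayCapture.not_tendsto_nhdsLT_of_isMaximalGeodesicOn`.

* `ray_mem_image_lateRegion` — the crux-vocabulary form (hypotheses = the five anchored-chart
  conjuncts of `Theses.ClusterCompleteness.RecurrentlyFlatDisperses`, verbatim).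

Mathlib + the Literature cone + landed bricks of this line; no definitions, no named facts.
-/

noncomputable section

open scoped Manifold ContDiff Topology
open Bundle Filter Set Function TopologicalSpace Literature.Geometry.Lorentzian

namespace Summit.FinalStateConjecture.FinalStateConjecture.Theorems.RecurrentlyFlatDisperses

namespace RayCapture

/-! ### Endpoints on a half-open parameter interval -/

/-- A future endpoint of a curve on the half-open parameter interval `[a, b)`, `a < b`, is a left
limit at `b`. -/
theorem tendsto_nhdsLT_of_hasFutureEndpoint_Ico {M : Type*} [TopologicalSpace M] {γ : ℝ → M}
    {a b : ℝ} (hab : a < b) {p : M} (h : HasFutureEndpoint γ (Ico a b) p) :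
    Tendsto γ (𝓝[<] b) (𝓝 p) := by
  rw [hasFutureEndpoint_iff ⟨a, left_mem_Ico.2 hab⟩] at h
  refine tendsto_def.2 fun V hV ↦ ?_
  obtain ⟨t, ht, htV⟩ := h V hV
  exact mem_of_superset (Ico_mem_nhdsLT ht.2) fun t' ht' ↦ htV t' ⟨ht.1.trans ht'.1, ht'.2⟩ ht'.1

/-! ### Maximal geodesics have no future endpoint -/

section Geodesic

open Literature.Geometry.Riemannian

variable {E : Type*} [NormedAddCommGroup E] [NormedSpace ℝ E] {H : Type*} [TopologicalSpace H]
  {I : ModelWithCorners ℝ E H} {M : Type*} [TopologicalSpace M] [ChartedSpace H M]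
  [IsManifold I ∞ M] [FiniteDimensional ℝ E] [CompleteSpace E] [T2Space M] [I.Boundaryless]
  {cov : CovariantDerivative I E (TangentSpace I : M → Type _)}
  [CovariantDerivative.ContMDiffCovariantDerivative cov 1]
  [CovariantDerivative.ContMDiffCovariantDerivative cov (⊤ : ℕ∞)]

/-- **A maximal geodesic does not converge at a finite end of its domain** (`C^∞` connection on a
Hausdorff manifold without boundary). If `γ` is a maximal geodesic on `dom ⊇ [t₀, b)` with
`b ∉ dom`, then `γ t` has no limit in `M` as `t ↑ b`: near a would-be limit `z` take a uniformly
normal neighbourhood `W ∋ z` (`exists_twoPoint_expInverse`); from some `t₂ < b` on `γ` stays in `W`,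
and re-based at `q = γ t₂` it is the radial geodesic `r ↦ exp_q (r v)`, `v = (b - t₂) γ' t₂`, for
`r ∈ [0, 1)`; a radial geodesic inside `W` which converges as `r ↑ 1` has `v ∈ 𝓔_q`
(`twoPoint_expInverse_eq_of_tendsto_radial`), i.e. `b - t₂` lies in the domain of the maximal
geodesic `γ_{γ' t₂}`, which is the translate of `dom` (maximality, `maximalGeodesic_unique`): so
`b ∈ dom`. O'Neill 1983, Ch. 5, Lemma 8 (a geodesic on `[0, b)` which is continuously extendible to
`b` is extendible as a geodesic). -/
theorem not_tendsto_nhdsLT_of_isMaximalGeodesicOn {γ : ℝ → M} {dom : Set ℝ}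
    (hγ : IsMaximalGeodesicOn cov γ dom) {t₀ b : ℝ} (ht₀b : t₀ < b) (hsub : Ico t₀ b ⊆ dom)
    (hb : b ∉ dom) (z : M) : ¬ Tendsto γ (𝓝[<] b) (𝓝 z) := by
  intro hlim
  haveI : BoundarylessManifold I M := inferInstance
  -- the uniformly normal neighbourhood of `z`
  obtain ⟨W, Src, Ξ, hWo, hzW, hWch, hSo, hW0, hSdom, hinj, hinv, hΞs, -⟩ :=
    exists_twoPoint_expInverse (cov := cov) z
  -- a parameter `t₂ ∈ [t₀, b)` from which on `γ` stays in `W`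
  obtain ⟨t₂, ht₀t₂, ht₂b, ht₂W⟩ : ∃ t₂, t₀ ≤ t₂ ∧ t₂ < b ∧ ∀ t ∈ Ico t₂ b, γ t ∈ W := by
    have h1 : γ ⁻¹' W ∈ 𝓝[<] b := hlim.eventually_mem (hWo.mem_nhds hzW)
    obtain ⟨l, hlb, hl⟩ := mem_nhdsLT_iff_exists_Ico_subset.1 h1
    exact ⟨max l t₀, le_max_right _ _, max_lt hlb ht₀b, fun t ht ↦
      hl ⟨(le_max_left _ _).trans ht.1, ht.2⟩⟩
  have hIsub : Ico t₂ b ⊆ dom := fun t ht ↦ hsub ⟨ht₀t₂.trans ht.1, ht.2⟩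
  set L : ℝ := b - t₂ with hL
  have hLpos : 0 < L := sub_pos.2 ht₂b
  -- re-base at `t₂`: the translate is the maximal geodesic `γ_w`, `w = γ' t₂`
  set q : M := γ t₂ with hq
  set w : TangentSpace I q := velocity I γ t₂ with hw
  set β : ℝ → M := fun u ↦ γ (u - (-t₂)) with hβ
  have hβmax : IsMaximalGeodesicOn cov β {u | u + t₂ ∈ dom} := hγ.comp_add t₂
  have hmemD : ∀ s : ℝ, 0 ≤ s → s < L → s ∈ {u : ℝ | u + t₂ ∈ dom} := fun s hs hsL ↦
    hIsub ⟨by linarith, by linarith⟩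
  have h0D : (0 : ℝ) ∈ {u : ℝ | u + t₂ ∈ dom} := hmemD 0 le_rfl hLpos
  have hβ0 : β 0 = q := by
    show γ (0 - -t₂) = γ t₂
    rw [zero_sub, neg_neg]
  have hβv : velocity I β 0 = w := by
    rw [hβ, velocity_comp_sub_const γ (-t₂) 0, zero_sub, neg_neg]
  obtain ⟨hDeq, heq⟩ := maximalGeodesic_unique hβmax h0D hβ0 hβv
  -- `exp_q (s w) = γ (s + t₂)` for `0 ≤ s < L`
  have hexp : ∀ s : ℝ, 0 ≤ s → s < L →
      s • w ∈ expDomain cov q ∧ expMap cov q (s • w) = γ (s + t₂) := by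
    intro s hs hsL
    have hsD : s ∈ maximalGeodesicDomain cov q w := by
      rw [← hDeq]
      exact hmemD s hs hsL
    obtain ⟨h1, h2⟩ := expMap_smul_of_mem (cov := cov) q w hsD
    refine ⟨h1, ?_⟩
    rw [h2, ← heq (hmemD s hs hsL)]
    show γ (s - -t₂) = γ (s + t₂)
    rw [sub_neg_eq_add]
  set v : TangentSpace I q := L • w with hv
  have hrv : ∀ r : ℝ, r • v = (r * L) • w := fun r ↦ by rw [hv, smul_smul]
  have hrL : ∀ r ∈ Ico (0 : ℝ) 1, 0 ≤ r * L ∧ r * L < L := fun r hr ↦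
    ⟨mul_nonneg hr.1 hLpos.le, mul_lt_of_lt_one_left hLpos hr.2⟩
  have hdom : ∀ r ∈ Ico (0 : ℝ) 1, r • v ∈ expDomain cov q := fun r hr ↦ by
    rw [hrv]
    exact (hexp (r * L) (hrL r hr).1 (hrL r hr).2).1
  have hW' : ∀ r ∈ Ico (0 : ℝ) 1, expMap cov q (r • v) ∈ W := fun r hr ↦ by
    rw [hrv, (hexp (r * L) (hrL r hr).1 (hrL r hr).2).2]
    exact ht₂W _ ⟨by linarith [(hrL r hr).1], by linarith [(hrL r hr).2]⟩
  have hqW : q ∈ W := ht₂W t₂ ⟨le_rfl, ht₂b⟩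
  -- the radial geodesic converges to `z` as `r ↑ 1`
  have haff : Tendsto (fun r : ℝ ↦ r * L + t₂) (𝓝[<] 1) (𝓝[<] b) := by
    refine tendsto_nhdsWithin_iff.2 ⟨?_, ?_⟩
    · have hc : Continuous fun r : ℝ ↦ r * L + t₂ := by fun_prop
      have h1 := hc.tendsto 1
      rw [one_mul, hL, sub_add_cancel] at h1
      exact h1.mono_left nhdsWithin_le_nhds
    · filter_upwards [self_mem_nhdsWithin] with r hr
      have h2 : r * L < L := mul_lt_of_lt_one_left hLpos hr
      show r * L + t₂ < b
      linarith
  have hlim' : Tendsto (fun r : ℝ ↦ expMap cov q (r • v)) (𝓝[<] 1) (𝓝 z) := by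
    have h1 : Tendsto (fun r : ℝ ↦ γ (r * L + t₂)) (𝓝[<] 1) (𝓝 z) := hlim.comp haff
    refine h1.congr' ?_
    filter_upwards [Ico_mem_nhdsLT one_pos] with r hr
    rw [hrv, (hexp (r * L) (hrL r hr).1 (hrL r hr).2).2]
  obtain ⟨-, -, hvmem, -⟩ := twoPoint_expInverse_eq_of_tendsto_radial z hWo hWch hSo hW0 hSdom
    hinj hinv hΞs hqW v hdom hW' hzW hlim'
  -- so `L ∈ dom γ_w`, i.e. `b ∈ dom`
  have hLD : L ∈ maximalGeodesicDomain cov q w :=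
    (mem_maximalGeodesicDomain_iff_smul_mem_expDomain (cov := cov) q w L).2 hvmem
  rw [← hDeq] at hLD
  have hLb : L + t₂ = b := by rw [hL, sub_add_cancel]
  exact hb (hLb ▸ hLD)

/-- **Final segments of a maximal geodesic with nowhere-vanishing velocity are future endless.**
For a `C^∞` connection on a Hausdorff manifold without boundary, a maximal geodesic `γ` on `dom`
with `γ' ≠ 0` on `dom` has no future endpoint on `dom ∩ [t₁, ∞)`, `t₁ ∈ dom`: if `dom` is
unbounded above the segment is the ray `[t₁, ∞)` and
`IsGeodesicOn.isFutureEndless_Ici_of_velocity_ne_zero` applies; otherwise it is `[t₁, sup dom)`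
with `sup dom ∉ dom` (`dom` is open) and `not_tendsto_nhdsLT_of_isMaximalGeodesicOn` applies. This
is the sense in which an inextendible causal geodesic is a future-inextendible causal curve of
causality theory (Hawking–Ellis 1973, §6.4; O'Neill 1983, Ch. 5, Lemma 8 and Ch. 14, Lemma 13). -/
theorem isFutureEndless_inter_Ici_of_isMaximalGeodesicOn {γ : ℝ → M} {dom : Set ℝ}
    (hγ : IsMaximalGeodesicOn cov γ dom) (hv : ∀ t ∈ dom, velocity I γ t ≠ 0) {t₁ : ℝ}
    (ht₁ : t₁ ∈ dom) : IsFutureEndless γ (dom ∩ Ici t₁) := by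
  refine ⟨⟨t₁, ht₁, self_mem_Ici⟩, fun p hp ↦ ?_⟩
  have hoc : dom.OrdConnected := hγ.2.1
  by_cases hbdd : BddAbove dom
  · -- bounded: `dom ∩ [t₁, ∞) = [t₁, b)` with `b = sup dom ∉ dom`
    set b : ℝ := sSup dom with hb
    have hne : dom.Nonempty := ⟨t₁, ht₁⟩
    have hle : ∀ t ∈ dom, t ≤ b := fun t ht ↦ le_csSup hbdd ht
    have hbnot : b ∉ dom := by
      intro hbd
      obtain ⟨ε, hε, hball⟩ := Metric.mem_nhds_iff.1 (hγ.isOpen.mem_nhds hbd)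
      have h1 : b + ε / 2 ∈ dom := hball (by
        rw [Metric.mem_ball, Real.dist_eq, add_sub_cancel_left, abs_of_pos (half_pos hε)]
        linarith)
      linarith [hle _ h1]
    have ht₁b : t₁ < b := lt_of_le_of_ne (hle t₁ ht₁) fun h ↦ hbnot (h ▸ ht₁)
    have hIco : Ico t₁ b ⊆ dom := fun t ht ↦ by
      obtain ⟨d, hd, htd⟩ := exists_lt_of_lt_csSup hne ht.2
      exact hoc.out ht₁ hd ⟨ht.1, htd.le⟩
    have hset : dom ∩ Ici t₁ = Ico t₁ b := by
      ext t
      exact ⟨fun ht ↦ ⟨ht.2, lt_of_le_of_ne (hle t ht.1) fun h ↦ hbnot (h ▸ ht.1)⟩,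
        fun ht ↦ ⟨hIco ht, ht.1⟩⟩
    rw [hset] at hp
    exact not_tendsto_nhdsLT_of_isMaximalGeodesicOn hγ ht₁b hIco hbnot p
      (tendsto_nhdsLT_of_hasFutureEndpoint_Ico ht₁b hp)
  · -- unbounded: `dom ∩ [t₁, ∞) = [t₁, ∞)`, a geodesic ray with nowhere-vanishing velocity
    have hIci : Ici t₁ ⊆ dom := fun t ht ↦ by
      obtain ⟨d, hd, htd⟩ := not_bddAbove_iff.1 hbdd t
      exact hoc.out ht₁ hd ⟨ht, htd.le⟩
    have hset : dom ∩ Ici t₁ = Ici t₁ :=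
      Subset.antisymm inter_subset_right fun t ht ↦ ⟨hIci ht, ht⟩
    rw [hset] at hp
    exact ((hγ.isGeodesicOn.mono hIci).isFutureEndless_Ici_of_velocity_ne_zero
      fun t ht ↦ hv t (hIci (mem_Ici.2 ht))).2 p hp

end Geodesic

/-! ### Null rays of a spacetime -/

section Spacetime

universe u

variable {n : ℕ} (𝓢 : Spacetime.{u} n) [𝓢.metric.HasLeviCivita]

/-- **The velocity of a null ray stays future null.** In a spacetime, along a maximal geodesic of
the Levi-Civita connection on `dom ∋ 0` with future null velocity at `0`, the velocity is future
null at every parameter of `dom` (`IsGeodesicOn.isNull_and_isFutureDirected_velocity`, with the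
`C¹` regularity of the Levi-Civita connection of the smooth metric,
`isLocallyContMDiff_leviCivita_holds`). -/
-- idiom copied from `nullRay_apply_mem_causalFuture`,
-- `Theorems/StarvedNecksHonestFixedRadiusSettlingStubEntryBookkeeping.lean`
theorem nullRay_velocity {γ : ℝ → 𝓢.carrier} {dom : Set ℝ}
    (hγ : IsMaximalGeodesicOn 𝓢.metric.leviCivita γ dom) (h0 : (0 : ℝ) ∈ dom)
    (hnull : 𝓢.metric.IsNull (velocity (𝓡 n) γ 0))
    (hfut : 𝓢.timeOrientation.IsFutureDirected (velocity (𝓡 n) γ 0)) {t : ℝ} (ht : t ∈ dom) :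
    𝓢.metric.IsNull (velocity (𝓡 n) γ t) ∧ 𝓢.timeOrientation.IsFutureDirected (velocity (𝓡 n) γ t) := by
  have hk1 : (((1 : ℕ∞) : ℕ∞ω)) + 1 ≤ ∞ := by exact_mod_cast le_top
  haveI : CovariantDerivative.ContMDiffCovariantDerivative 𝓢.metric.leviCivita 1 :=
    ⟨𝓢.metric.isLocallyContMDiff_leviCivita_holds 1 hk1 univ isOpen_univ⟩
  exact hγ.isGeodesicOn.isNull_and_isFutureDirected_velocity 𝓢.metric 𝓢.timeOrientation hγ.isOpen
    hγ.2.1 h0 hnull hfut ht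

/-- **A null ray is a future causal curve on its whole domain.** -/
theorem nullRay_isFutureCausalCurveOn {γ : ℝ → 𝓢.carrier} {dom : Set ℝ}
    (hγ : IsMaximalGeodesicOn 𝓢.metric.leviCivita γ dom) (h0 : (0 : ℝ) ∈ dom)
    (hnull : 𝓢.metric.IsNull (velocity (𝓡 n) γ 0))
    (hfut : 𝓢.timeOrientation.IsFutureDirected (velocity (𝓡 n) γ 0)) :
    𝓢.metric.IsFutureCausalCurveOn 𝓢.timeOrientation γ dom := fun _ ht ↦
  ⟨IsGeodesicOn.mdifferentiableAt_holds hγ.isGeodesicOn ht,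
    (nullRay_velocity 𝓢 hγ h0 hnull hfut ht).2⟩

/-- **Points of a null ray are causally after its earlier points**: for `a ≤ b` in `dom`,
`γ b ∈ J⁺(γ a)` (the segment `γ|[a, b]` is a future causal curve). -/
-- copied from `nullRay_apply_mem_causalFuture`,
-- `Theorems/StarvedNecksHonestFixedRadiusSettlingStubEntryBookkeeping.lean`
theorem nullRay_apply_mem_causalFuture {γ : ℝ → 𝓢.carrier} {dom : Set ℝ}
    (hγ : IsMaximalGeodesicOn 𝓢.metric.leviCivita γ dom) (h0 : (0 : ℝ) ∈ dom)
    (hnull : 𝓢.metric.IsNull (velocity (𝓡 n) γ 0))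
    (hfut : 𝓢.timeOrientation.IsFutureDirected (velocity (𝓡 n) γ 0))
    {a b : ℝ} (ha : a ∈ dom) (hb : b ∈ dom) (hab : a ≤ b) :
    γ b ∈ 𝓢.metric.causalFuture 𝓢.timeOrientation {γ a} :=
  IsFutureCausalCurveOn.apply_mem_causalFuture 𝓢.timeOrientation hab
    ((nullRay_isFutureCausalCurveOn 𝓢 hγ h0 hnull hfut).mono fun _ ht ↦ hγ.2.1.out ha hb ht)

/-- **Final segments of a null ray are future endless.** In a spacetime, a maximal geodesic of the
Levi-Civita connection on `dom ∋ 0` with future null velocity at `0` has no future endpoint on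
`dom ∩ [t₁, ∞)`, `t₁ ∈ dom` (`RayCapture.isFutureEndless_inter_Ici_of_isMaximalGeodesicOn` for the
smooth Levi-Civita connection; a null vector is non-zero). -/
theorem nullRay_isFutureEndless_inter_Ici {γ : ℝ → 𝓢.carrier} {dom : Set ℝ}
    (hγ : IsMaximalGeodesicOn 𝓢.metric.leviCivita γ dom) (h0 : (0 : ℝ) ∈ dom)
    (hnull : 𝓢.metric.IsNull (velocity (𝓡 n) γ 0))
    (hfut : 𝓢.timeOrientation.IsFutureDirected (velocity (𝓡 n) γ 0)) {t₁ : ℝ} (ht₁ : t₁ ∈ dom) :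
    IsFutureEndless γ (dom ∩ Ici t₁) := by
  have hk1 : (((1 : ℕ∞) : ℕ∞ω)) + 1 ≤ ∞ := by exact_mod_cast le_top
  have hkT : (((⊤ : ℕ∞) : ℕ∞ω)) + 1 ≤ ∞ := by exact_mod_cast le_top
  haveI : CovariantDerivative.ContMDiffCovariantDerivative 𝓢.metric.leviCivita 1 :=
    ⟨𝓢.metric.isLocallyContMDiff_leviCivita_holds 1 hk1 univ isOpen_univ⟩
  haveI : CovariantDerivative.ContMDiffCovariantDerivative 𝓢.metric.leviCivita (⊤ : ℕ∞) :=
    ⟨𝓢.metric.isLocallyContMDiff_leviCivita_holds ⊤ hkT univ isOpen_univ⟩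
  exact isFutureEndless_inter_Ici_of_isMaximalGeodesicOn hγ
    (fun t ht ↦ (nullRay_velocity 𝓢 hγ h0 hnull hfut ht).1.2) ht₁

end Spacetime

end RayCapture

/-! ### The crux-vocabulary form -/

/-- **A normalised null ray which meets the crux's anchored chart region stays in it and reaches
every late region.** In a maximal vacuum Cauchy development of admissible data, for an anchored flat
late chart of the crux's shape (hypotheses = the five anchored-chart conjuncts of
`Theses.ClusterCompleteness.RecurrentlyFlatDisperses`, verbatim) and for the Levi-Civita connection
of the metric granted its existence: if a normalised null ray `γ` from the data (maximal null
geodesic, `IsNormalisedNullRayFrom`) satisfies `γ t₁ ∈ W = Ψ₀ '' lateRegion τ₀` at some `t₁` of its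
domain, then (i) `γ t ∈ W` for every later `t` of its domain (`J⁺(W) ⊆ W`,
`causalFuture_image_lateRegion_subset`; the ray is a future causal curve), and (ii) for every chart
time `T` there is a later parameter of its domain at which `γ` lies in `Ψ₀ '' lateRegion T`
(`exists_mem_image_lateRegion` on the final segment `dom ∩ [t₁, ∞)`, which is future endless by
`RayCapture.nullRay_isFutureEndless_inter_Ici`). -/
theorem ray_mem_image_lateRegion :
    ∀ (X : Type) [TopologicalSpace X] [ChartedSpace E3 X] [IsManifold (𝓡 3) ∞ X] [T2Space X]
      [SecondCountableTopology X] [ConnectedSpace X],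
      ∀ D ∈ admissibleVacuumData X, ∀ 𝒟 : VacuumCauchyDevelopment D, 𝒟.IsMaximal →
        ∀ (O : Set 𝒟.carrier) (τ₀ : ℝ) (U₀ : Opens E4) (Ψ₀ : U₀ → 𝒟.carrier),
          (𝒟.toSpacetime.IsLateChart (Minkowski.backgroundOn U₀) O τ₀ Ψ₀ ∧
            {x : E4 | τ₀ < x 0} ⊆ (U₀ : Set E4) ∧
            O = Summit.FinalStateConjecture.exteriorOf 𝒟.toCauchyDevelopment
              (Ψ₀ '' (Minkowski.backgroundOn U₀).lateRegion τ₀) ∧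
            (∀ τ₁ : ℝ, τ₀ < τ₁ → O \ Ψ₀ '' (Minkowski.backgroundOn U₀).lateRegion τ₁ ⊆
              𝒟.metric.causalPast 𝒟.timeOrientation
                (Ψ₀ '' (Minkowski.backgroundOn U₀).timeSlab τ₁)) ∧
            (∀ τ : ℝ, τ₀ < τ → 𝒟.toSpacetime.deviationCk (Minkowski.backgroundOn U₀) Ψ₀ 0 τ ≤
              ENNReal.ofReal (1 / 4))) →
          ∀ [𝒟.metric.HasLeviCivita] (p : X) (γ : ℝ → 𝒟.carrier) (dom : Set ℝ),
            𝒟.metric.IsNormalisedNullRayFrom 𝒟.timeOrientation 𝒟.embed 𝒟.normal p γ dom →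
            ∀ t₁ ∈ dom, γ t₁ ∈ Ψ₀ '' (Minkowski.backgroundOn U₀).lateRegion τ₀ →
              (∀ t ∈ dom, t₁ ≤ t → γ t ∈ Ψ₀ '' (Minkowski.backgroundOn U₀).lateRegion τ₀) ∧
              ∀ T : ℝ, ∃ t ∈ dom, t₁ ≤ t ∧ γ t ∈ Ψ₀ '' (Minkowski.backgroundOn U₀).lateRegion T := by
  intro X _ _ _ _ _ _ D hD 𝒟 hmax O τ₀ U₀ Ψ₀ hyp _ p γ dom hγ t₁ ht₁ hγt₁
  have hJ := causalFuture_image_lateRegion_subset X D hD 𝒟 hmax O τ₀ U₀ Ψ₀ hyp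
  have hmaxg := hγ.isMaximalGeodesicOn
  have h0 := hγ.zero_mem
  have hnull := hγ.isNull_velocity
  have hfut := hγ.isFutureDirected_velocity
  have hcausal : 𝒟.metric.IsFutureCausalCurveOn 𝒟.timeOrientation γ dom :=
    RayCapture.nullRay_isFutureCausalCurveOn 𝒟.toSpacetime hmaxg h0 hnull hfut
  refine ⟨fun t ht ht₁t ↦ ?_, fun T ↦ ?_⟩
  · -- (i) `γ t ∈ J⁺(γ t₁) ⊆ J⁺(W) ⊆ W`
    have h1 : γ t ∈ 𝒟.metric.causalFuture 𝒟.timeOrientation {γ t₁} :=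
      RayCapture.nullRay_apply_mem_causalFuture 𝒟.toSpacetime hmaxg h0 hnull hfut ht₁ ht ht₁t
    exact hJ (LorentzianMetric.causalFuture_mono (singleton_subset_iff.2 hγt₁) h1)
  · -- (ii) chart time is exhausted along the future-endless final segment of the ray
    have hend : IsFutureEndless γ (dom ∩ Ici t₁) :=
      RayCapture.nullRay_isFutureEndless_inter_Ici 𝒟.toSpacetime hmaxg h0 hnull hfut ht₁
    obtain ⟨t, ht, ht₁t, hT⟩ := exists_mem_image_lateRegion X D hD 𝒟 hmax O τ₀ U₀ Ψ₀ hyp γ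
      (dom ∩ Ici t₁) (hmaxg.2.1.inter ordConnected_Ici) (hcausal.mono inter_subset_left) hend t₁
      ⟨ht₁, self_mem_Ici⟩ hγt₁ T
    exact ⟨t, ht.1, ht₁t, hT⟩

end Summit.FinalStateConjecture.FinalStateConjecture.Theorems.RecurrentlyFlatDisperses

end
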